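import Literature.MathematicalPhysics.QuantumFieldTheory.ConformalBootstrap3D.HRCoeffCellBounds
import Literature.MathematicalPhysics.QuantumFieldTheory.ConformalBootstrap3D.BlockZSeries
import Literature.Analysis.ValidatedNumerics.MultiPrecisionInterval
import Literature.Analysis.ValidatedNumerics.KernelData

/-!
# Kernel arithmetic for point-functional certificates (pub-ising3d, architecture B″): exact mirrors

The finite tables of `boxExcluded_of_pointTable_twist` (`PointCertificateTwistGap.lean`) are
inequalities between real numbers built from RATIONAL certificate data — nodes `z_k, z̄_k`, weights
`w_k`, cell end points — by `+ − × /`, the Hogervorst–Rychkov recursion (`hrCoeff`, `pivotProd`),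
the Legendre forms `𝒫_j` (`zLegendre`) and real powers `u^c` of rationals `u ∈ (0,1)` with rational
exponents. This file is the EXACT half of a kernel evaluator for them (the interval half is
`PointKernelPowers.lean`): computable `ℚ`-valued mirrors of the tree's `ℝ`-valued definitions,
each with a cast lemma, in a shape the Lean kernel reduces quickly (`decide +kernel`; structural
recursion, tabulated rows — `Literature/Computation/README.lean` §3):

* `legendreLamQ i` (`= λ_i`, by the recurrence `λ_{i+1} = λ_i (2i+1)/(2i+2)`), `zLegendreQ j x y`
  (`= 𝒫_j(x,y)`), `legTab J x y` (the row `j ≤ J` tabulated once; `vget_legTab`);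
* `casimirPivotQ`, `hrGammaPlusQ`, `hrGammaMinusQ`, `hrRowQ Δ ℓ n` (level `n` of the HR array as a
  list, computed row by row — the naive recursion is exponential), `hrCoeffQ` (`cast_hrCoeffQ`),
  `levelPivotProdQ`, `pivotProdQ` (`cast_pivotProdQ`).

All statements are `((fQ … : ℚ) : ℝ) = f …` for the tree's `f`. Source of the recursions:
Hogervorst–Rychkov 2013, §3 eqs. (3.6)–(3.9). [cite: HogervorstRychkov2013, §3 eq. (3.9)]
-/

namespace Literature.MathematicalPhysics.QuantumFieldTheory.ConformalBootstrap3D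

namespace PointKernel

open Finset
open Literature.Analysis.ValidatedNumerics (rsum vget vtab rsum_eq_sum vget_vtab vget_of_length_le)

/-! ### `λ_i` and the Legendre form `𝒫_j` -/

/-- `λ_i = C(2i,i)/4^i` by the recurrence `λ_0 = 1`, `λ_{i+1} = λ_i (2i+1)/(2i+2)`. [folklore] -/
def legendreLamQ : ℕ → ℚ
  | 0 => 1
  | i + 1 => legendreLamQ i * (2 * (i : ℚ) + 1) / (2 * (i : ℚ) + 2)

/-- [folklore] -/
theorem cast_legendreLamQ (i : ℕ) : ((legendreLamQ i : ℚ) : ℝ) = legendreLam i := by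
  induction i with
  | zero => simp [legendreLamQ]
  | succ i ih =>
    rw [legendreLam_succ, ← ih]
    simp only [legendreLamQ]
    push_cast
    ring

/-- The recurrence `(2i+2) λ_{i+1} = (2i+1) λ_i`. [folklore] -/
theorem legendreLamQ_succ_mul (i : ℕ) :
    (2 * (i : ℚ) + 2) * legendreLamQ (i + 1) = (2 * (i : ℚ) + 1) * legendreLamQ i := by
  simp only [legendreLamQ]
  have h : (2 * (i : ℚ) + 2) ≠ 0 := by positivity
  field_simp

/-- `λ_i` in terms of `λ_{i+1}`: `λ_i = λ_{i+1} (2i+2)/(2i+1)`. [folklore] -/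
theorem legendreLamQ_eq_succ (i : ℕ) :
    legendreLamQ i = legendreLamQ (i + 1) * (2 * (i : ℚ) + 2) / (2 * (i : ℚ) + 1) := by
  have h : (2 * (i : ℚ) + 1) ≠ 0 := by positivity
  rw [eq_div_iff h]
  linear_combination (-1 : ℚ) * legendreLamQ_succ_mul i

/-- `𝒫_j(x,y) = Σ_{i+r=j} λ_i λ_r x^i y^r` over `ℚ`. [cite: HogervorstRychkov2013, §3 eq. (3.6)] -/
def zLegendreQ (j : ℕ) (x y : ℚ) : ℚ :=
  ∑ c ∈ antidiagonal j, legendreLamQ c.1 * legendreLamQ c.2 * x ^ c.1 * y ^ c.2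

/-- [cite: HogervorstRychkov2013, §3 eq. (3.6)] -/
theorem cast_zLegendreQ (j : ℕ) (x y : ℚ) :
    ((zLegendreQ j x y : ℚ) : ℝ) = zLegendre j (x : ℝ) (y : ℝ) := by
  unfold zLegendreQ zLegendre
  push_cast
  refine sum_congr rfl fun c _ => ?_
  rw [cast_legendreLamQ, cast_legendreLamQ]

/-- [folklore] -/
theorem zLegendreQ_zero (x y : ℚ) : zLegendreQ 0 x y = 1 := by
  simp [zLegendreQ, legendreLamQ]

/-- [folklore] -/
theorem zLegendreQ_one (x y : ℚ) : zLegendreQ 1 x y = (x + y) / 2 := by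
  rw [zLegendreQ, Finset.Nat.antidiagonal_succ]
  simp [legendreLamQ]
  ring

/-- **Three-term recurrence** of the Legendre forms (Bonnet's recursion
`(j+1) P_{j+1}(ξ) = (2j+1) ξ P_j(ξ) - j P_{j-1}(ξ)` at `s^j P_j(ξ)`, `s² = xy`, `2sξ = x + y`):
`(2n+4) 𝒫_{n+2} = (2n+3)(x+y) 𝒫_{n+1} - (2n+2) xy 𝒫_n`. [folklore] -/
theorem zLegendreQ_rec (n : ℕ) (x y : ℚ) :
    (2 * (n : ℚ) + 4) * zLegendreQ (n + 2) x y =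
      (2 * (n : ℚ) + 3) * (x + y) * zLegendreQ (n + 1) x y
        - (2 * (n : ℚ) + 2) * (x * y) * zLegendreQ n x y := by
  -- the three shifted coefficient arrays on `antidiagonal (n+2)`
  set A : ℕ × ℕ → ℚ := fun c => if c.1 = 0 then 0 else legendreLamQ (c.1 - 1) * legendreLamQ c.2
    with hA
  set B : ℕ × ℕ → ℚ := fun c => if c.2 = 0 then 0 else legendreLamQ c.1 * legendreLamQ (c.2 - 1)
    with hB
  set C : ℕ × ℕ → ℚ := fun c =>
    if c.1 = 0 ∨ c.2 = 0 then 0 else legendreLamQ (c.1 - 1) * legendreLamQ (c.2 - 1) with hC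
  have hAs : ∑ c ∈ antidiagonal (n + 2), A c * x ^ c.1 * y ^ c.2 =
      ∑ c ∈ antidiagonal (n + 1), legendreLamQ c.1 * legendreLamQ c.2 * x ^ (c.1 + 1) * y ^ c.2 := by
    rw [Finset.Nat.sum_antidiagonal_succ]
    simp [hA]
  have hBs : ∑ c ∈ antidiagonal (n + 2), B c * x ^ c.1 * y ^ c.2 =
      ∑ c ∈ antidiagonal (n + 1), legendreLamQ c.1 * legendreLamQ c.2 * x ^ c.1 * y ^ (c.2 + 1) := by
    rw [Finset.Nat.sum_antidiagonal_succ']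
    simp [hB]
  have hCs : ∑ c ∈ antidiagonal (n + 2), C c * x ^ c.1 * y ^ c.2 =
      ∑ c ∈ antidiagonal n, legendreLamQ c.1 * legendreLamQ c.2 * x ^ (c.1 + 1) * y ^ (c.2 + 1) := by
    rw [Finset.Nat.sum_antidiagonal_succ]
    simp only [hC]
    rw [Finset.Nat.sum_antidiagonal_succ']
    simp
  -- both sides as sums over `antidiagonal (n+2)`
  have hL : (2 * (n : ℚ) + 4) * zLegendreQ (n + 2) x y =
      ∑ c ∈ antidiagonal (n + 2), (2 * (n : ℚ) + 4) * (legendreLamQ c.1 * legendreLamQ c.2) *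
        x ^ c.1 * y ^ c.2 := by
    rw [zLegendreQ, mul_sum]
    refine sum_congr rfl fun c _ => by ring
  have hR : (2 * (n : ℚ) + 3) * (x + y) * zLegendreQ (n + 1) x y
        - (2 * (n : ℚ) + 2) * (x * y) * zLegendreQ n x y =
      ∑ c ∈ antidiagonal (n + 2), ((2 * (n : ℚ) + 3) * (A c + B c) - (2 * (n : ℚ) + 2) * C c) *
        x ^ c.1 * y ^ c.2 := by
    have e1 : ∑ c ∈ antidiagonal (n + 2), ((2 * (n : ℚ) + 3) * (A c + B c) - (2 * (n : ℚ) + 2) * C c) *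
          x ^ c.1 * y ^ c.2 =
        (2 * (n : ℚ) + 3) * (∑ c ∈ antidiagonal (n + 2), A c * x ^ c.1 * y ^ c.2
            + ∑ c ∈ antidiagonal (n + 2), B c * x ^ c.1 * y ^ c.2)
          - (2 * (n : ℚ) + 2) * ∑ c ∈ antidiagonal (n + 2), C c * x ^ c.1 * y ^ c.2 := by
      rw [← sum_add_distrib, mul_sum, mul_sum, ← sum_sub_distrib]
      refine sum_congr rfl fun c _ => by ring
    rw [e1, hAs, hBs, hCs, zLegendreQ, zLegendreQ, mul_sum, ← sum_add_distrib, mul_sum, mul_sum, mul_sum]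
    congr 1
    · refine sum_congr rfl fun c _ => by ring
    · refine sum_congr rfl fun c _ => by ring
  rw [hL, hR]
  refine sum_congr rfl fun c hc => ?_
  rw [mem_antidiagonal] at hc
  obtain ⟨i, r⟩ := c
  simp only at hc ⊢
  -- the coefficient identity
  have key : (2 * (n : ℚ) + 4) * (legendreLamQ i * legendreLamQ r) =
      (2 * (n : ℚ) + 3) * (A (i, r) + B (i, r)) - (2 * (n : ℚ) + 2) * C (i, r) := by
    simp only [hA, hB, hC]
    rcases i with _ | i'
    · -- i = 0, r = n + 2
      have hr : r = n + 1 + 1 := by omega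
      subst hr
      simp only [if_true, true_or, zero_add, mul_zero, sub_zero, Nat.add_eq_zero_iff, one_ne_zero,
        and_false, if_false, Nat.add_sub_cancel]
      have h := legendreLamQ_succ_mul (n + 1)
      push_cast at h
      rw [show legendreLamQ 0 = 1 from rfl]
      linear_combination h
    · rcases r with _ | r'
      · -- r = 0
        have hi : i' = n + 1 := by omega
        subst hi
        simp only [Nat.add_eq_zero_iff, one_ne_zero, and_false, if_false, if_true, or_true, add_zero,
          mul_zero, sub_zero, Nat.add_sub_cancel]
        have h := legendreLamQ_succ_mul (n + 1)
        push_cast at h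
        rw [show legendreLamQ 0 = 1 from rfl]
        linear_combination h
      · -- i = i'+1, r = r'+1, i' + r' = n
        have hn : (n : ℚ) = i' + r' := by exact_mod_cast (by omega : n = i' + r')
        simp only [Nat.add_eq_zero_iff, one_ne_zero, and_false, if_false, or_self, Nat.add_sub_cancel]
        rw [legendreLamQ_eq_succ i', legendreLamQ_eq_succ r', hn]
        have h1 : (2 * (i' : ℚ) + 1) ≠ 0 := by positivity
        have h2 : (2 * (r' : ℚ) + 1) ≠ 0 := by positivity
        field_simp
        ring
  rw [key]

/-- The list `[𝒫_j, 𝒫_{j+1}, …]` of length `fuel` from the pair `(𝒫_j, 𝒫_{j+1}) = (a, b)` by the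
three-term recurrence (structural, `O(fuel)` operations). [folklore] -/
def legListAux (x y : ℚ) : ℕ → ℚ → ℚ → ℕ → List ℚ
  | 0, _, _, _ => []
  | fuel + 1, a, b, j =>
    a :: legListAux x y fuel b
      (((2 * (j : ℚ) + 3) * (x + y) * b - (2 * (j : ℚ) + 2) * (x * y) * a) / (2 * (j : ℚ) + 4)) (j + 1)

/-- The row `[𝒫_0(x,y), …, 𝒫_J(x,y)]`. [cite: HogervorstRychkov2013, §3 eq. (3.6)] -/
def legTab (J : ℕ) (x y : ℚ) : List ℚ := legListAux x y (J + 1) 1 ((x + y) / 2) 0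

/-- [folklore] -/
theorem vget_legListAux (x y : ℚ) : ∀ (fuel j i : ℕ), i < fuel →
    vget (legListAux x y fuel (zLegendreQ j x y) (zLegendreQ (j + 1) x y) j) i = zLegendreQ (j + i) x y
  | 0, _, _, h => absurd h (Nat.not_lt_zero _)
  | fuel + 1, j, 0, _ => by simp [legListAux]
  | fuel + 1, j, i + 1, h => by
    rw [legListAux, Literature.Analysis.ValidatedNumerics.vget_cons_succ]
    have e : ((2 * (j : ℚ) + 3) * (x + y) * zLegendreQ (j + 1) x y
        - (2 * (j : ℚ) + 2) * (x * y) * zLegendreQ j x y) / (2 * (j : ℚ) + 4) = zLegendreQ (j + 2) x y := by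
      rw [div_eq_iff (by positivity), eq_comm, mul_comm]
      exact zLegendreQ_rec j x y
    rw [e, show j + 2 = (j + 1) + 1 from rfl, vget_legListAux x y fuel (j + 1) i (by omega)]
    congr 1; omega

/-- [cite: HogervorstRychkov2013, §3 eq. (3.6)] -/
theorem vget_legTab {J j : ℕ} (hj : j ≤ J) (x y : ℚ) : vget (legTab J x y) j = zLegendreQ j x y := by
  unfold legTab
  rw [← zLegendreQ_zero x y, ← zLegendreQ_one x y]
  rw [vget_legListAux x y (J + 1) 0 j (by omega)]
  simp

/-! ### The Hogervorst–Rychkov array over `ℚ` -/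

/-- `casimirPivot3D` over `ℚ`. [cite: HogervorstRychkov2013, §4 after eq. (4.7)] -/
def casimirPivotQ (Δ : ℚ) (ℓ n j : ℕ) : ℚ :=
  2 * (n : ℚ) * Δ + (n : ℚ) * ((n : ℚ) - 3) + (j : ℚ) * ((j : ℚ) + 1) - (ℓ : ℚ) * ((ℓ : ℚ) + 1)

/-- [folklore] -/
theorem cast_casimirPivotQ (Δ : ℚ) (ℓ n j : ℕ) :
    ((casimirPivotQ Δ ℓ n j : ℚ) : ℝ) = casimirPivot3D (Δ : ℝ) ℓ n j := by
  unfold casimirPivotQ casimirPivot3D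
  push_cast
  ring

/-- `γ⁺` over `ℚ`. [cite: HogervorstRychkov2013, §3 eq. (3.8)] -/
def hrGammaPlusQ (E : ℚ) (j : ℕ) : ℚ :=
  (E + (j : ℚ)) ^ 2 * ((j : ℚ) + 1) / (2 * (j : ℚ) + 1)

/-- `γ⁻` over `ℚ`. [cite: HogervorstRychkov2013, §3 eq. (3.8)] -/
def hrGammaMinusQ (E : ℚ) (j : ℕ) : ℚ :=
  (E - (j : ℚ) - 1) ^ 2 * (j : ℚ) / (2 * (j : ℚ) + 1)

/-- [folklore] -/
theorem cast_hrGammaPlusQ (E : ℚ) (j : ℕ) : ((hrGammaPlusQ E j : ℚ) : ℝ) = hrGammaPlus (E : ℝ) j := by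
  unfold hrGammaPlusQ hrGammaPlus
  push_cast
  ring

/-- [folklore] -/
theorem cast_hrGammaMinusQ (E : ℚ) (j : ℕ) :
    ((hrGammaMinusQ E j : ℚ) : ℝ) = hrGammaMinus (E : ℝ) j := by
  unfold hrGammaMinusQ hrGammaMinus
  push_cast
  ring

/-- One step of the HR recursion on a tabulated level: entry `j` of level `n+1` from the list
`row` of level `n` (entries beyond the list read as `0`). [cite: HogervorstRychkov2013, §3 eq. (3.9)] -/
def hrStepQ (Δ : ℚ) (ℓ n : ℕ) (row : List ℚ) (j : ℕ) : ℚ :=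
  ((if j = 0 then 0 else hrGammaPlusQ (Δ + n) (j - 1) * vget row (j - 1)) +
      hrGammaMinusQ (Δ + n) (j + 1) * vget row (j + 1)) /
    casimirPivotQ Δ ℓ (n + 1) j

/-- Level `n` of the HR array `A_{n,j}(Δ, ℓ)`, `j = 0, …, ℓ + n`, as a list (row-by-row
tabulation). [cite: HogervorstRychkov2013, §3 eq. (3.9)] -/
def hrRowQ (Δ : ℚ) (ℓ : ℕ) : ℕ → List ℚ
  | 0 => vtab (ℓ + 1) fun j => if j = ℓ then 1 else 0
  | n + 1 => vtab (ℓ + n + 2) (hrStepQ Δ ℓ n (hrRowQ Δ ℓ n))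

/-- `A_{n,j}(Δ, ℓ)` over `ℚ` (read off the tabulated level). [cite: HogervorstRychkov2013, §3 eq. (3.9)] -/
def hrCoeffQ (Δ : ℚ) (ℓ n j : ℕ) : ℚ := vget (hrRowQ Δ ℓ n) j

/-- [cite: HogervorstRychkov2013, §3 eq. (3.9)] -/
theorem cast_hrCoeffQ (Δ : ℚ) (ℓ : ℕ) : ∀ n j : ℕ, ((hrCoeffQ Δ ℓ n j : ℚ) : ℝ) = hrCoeff (Δ : ℝ) ℓ n j
  | 0, j => by
    unfold hrCoeffQ hrRowQ
    by_cases hj : j < ℓ + 1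
    · rw [vget_vtab _ hj]
      simp only [hrCoeff]
      split_ifs <;> simp
    · rw [vget_of_length_le (by simp; omega), hrCoeff_zero_of_ne _ (by omega)]
      simp
  | n + 1, j => by
    unfold hrCoeffQ
    simp only [hrRowQ]
    by_cases hj : j < ℓ + n + 2
    · rw [vget_vtab _ hj, hrCoeff_succ]
      unfold hrStepQ
      have h1 := cast_hrCoeffQ Δ ℓ n (j - 1)
      have h2 := cast_hrCoeffQ Δ ℓ n (j + 1)
      unfold hrCoeffQ at h1 h2
      split_ifs with hj0
      · push_cast
        rw [h2, cast_hrGammaMinusQ, cast_casimirPivotQ]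
        push_cast
        ring
      · push_cast
        rw [h1, h2, cast_hrGammaPlusQ, cast_hrGammaMinusQ, cast_casimirPivotQ]
        push_cast
        ring
    · rw [vget_of_length_le (by simp; omega),
        hrCoeff_eq_zero_of_not_inDescendantRange _ (by unfold InDescendantRange; omega)]
      simp

/-- `levelPivotProd` over `ℚ`. [cite: HogervorstRychkov2013, §3 eq. (3.9)] -/
def levelPivotProdQ (Δ : ℚ) (ℓ m : ℕ) : ℚ :=
  ∏ i ∈ descendantLevel ℓ m, casimirPivotQ Δ ℓ m i

/-- `pivotProd` over `ℚ`. [cite: HogervorstRychkov2013, §3 eq. (3.9)] -/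
def pivotProdQ (Δ : ℚ) (ℓ n : ℕ) : ℚ :=
  ∏ m ∈ Finset.Ico 2 (n + 1), levelPivotProdQ Δ ℓ m

/-- [folklore] -/
theorem cast_pivotProdQ (Δ : ℚ) (ℓ n : ℕ) : ((pivotProdQ Δ ℓ n : ℚ) : ℝ) = pivotProd (Δ : ℝ) ℓ n := by
  unfold pivotProdQ pivotProd levelPivotProdQ levelPivotProd
  push_cast
  refine prod_congr rfl fun m _ => prod_congr rfl fun i _ => cast_casimirPivotQ Δ ℓ m i

end PointKernel

end Literature.MathematicalPhysics.QuantumFieldTheory.ConformalBootstrap3D
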